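import Summits.BirchSwinnertonDyer.BirchSwinnertonDyer.Theses.PrintCf2
import Summits.BirchSwinnertonDyer.BirchSwinnertonDyer.Theorems.CMKolyvaginAtInertTwoLevelZeroOneBitBSDTwoOfPrintedInputs
import HarnessLib

/-!
# `PrintCf2.InertTwoLevelZeroOneBitHeegnerOfFactsPlus` holds (aside stmt-BirchSwinnertonDyer-28579, route PrintCf2)

Cell `bsd-print-cf2`, referee batch b2 (2026-08-30): the one-bit widening of the booked level-zero aside 28275 — the
aside's text is, binder for binder, the type of bsd-line-cmk2-p1 g21's
`Summit.BirchSwinnertonDyer.BirchSwinnertonDyer.Theorems.KolyvaginLowerTwo.bsdp_two_of_levelZero_of_sum_defect_le_one_of_printedInputs`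
(p760958) with the three leading print binders in the order `(hnf, hGZ, hGZK, …)` instead of `(hGZ, hGZK, hnf, …)`.
Pure plumbing: `intro`s + one `exact`. No summit statement is proved here; the aside is conditional on its six printed
inputs; BSD is not proved by any of this.
-/

set_option autoImplicit false
set_option linter.dupNamespace false

namespace Summit.BirchSwinnertonDyer.BirchSwinnertonDyer.Theorems.PrintCf2

/-- The aside `InertTwoLevelZeroOneBitHeegnerOfFactsPlus` of route `PrintCf2` (item stmt-BirchSwinnertonDyer-28579) holds:
cmk2-p1 g21's level-zero one-bit class theorem `bsdp_two_of_levelZero_of_sum_defect_le_one_of_printedInputs` (p760958),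
binders reordered. -/
theorem inertTwoLevelZeroOneBitHeegnerOfFactsPlus_proof :
    Summit.BirchSwinnertonDyer.BirchSwinnertonDyer.Theses.PrintCf2.InertTwoLevelZeroOneBitHeegnerOfFactsPlus := by
  intro hnf hGZall hGZK hMilne hBF W _ _ _ hCM hin hsurj hr hT K _ _ hK hodd h3 hH hdef h372 Dt hopt hc β ι d₁ hy h2
  exact Summit.BirchSwinnertonDyer.BirchSwinnertonDyer.Theorems.KolyvaginLowerTwo.bsdp_two_of_levelZero_of_sum_defect_le_one_of_printedInputs
    hGZall hGZK hnf hMilne hBF W hCM hin hsurj hr hT K hK hodd h3 hH hdef h372 Dt hopt hc β ι d₁ hy h2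

end Summit.BirchSwinnertonDyer.BirchSwinnertonDyer.Theorems.PrintCf2
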